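import Literature.Analysis.FluidPDE.LeiRenZhang2019Liouville
import Literature.Analysis.FluidPDE.PeriodicWindowIntegral
import HarnessLib

/-!
# Lei–Ren–Zhang 2019, proof of Theorem 1.1: the smooth periodic swirl data of a bounded weak solution

Analysis/FluidPDE proofs file (theorems only, no definitions, no named facts), on the discharge
path of the named fact `Literature.Analysis.FluidPDE.leiRenZhang2019_liouville_periodic`
(Z. Lei, X. Ren, Q. S. Zhang, arXiv:1902.11229 = Math. Ann. 383 (2022), Theorem 1.1). The paper
works with bounded *mild* ancient solutions, which are smooth with all derivatives bounded
(p. 2: "we just use the boundedness of `|rv_θ|`"; the equation (1.5) for `Γ = r v_θ` is used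
classically in §§2–3). In the tree this regularity is KNSS 2009, §4
(`KNSS2009_regularity_axisymmetric_swirl_holds`): a bounded weak solution with a.e.-axisymmetric
slices has a smooth representative `U(t) + β(t) e_z` with `U(t)` axisymmetric, divergence-free,
all derivatives bounded and Lipschitz in time, and `Γ = swirl ∘ U` satisfies (1.5) integrated in
time off the axis. This file packages, for an a.e. axially `P`-periodic solution with bounded
swirl, exactly the hypotheses `h1`–`h11` of `LeiRenZhang2019.bundle_of_periodic_swirl_setting`
(`PeriodicSwirlSetting`) — the periodicity of `U(t)` being recovered from the a.e. periodicity of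
the slices by continuity — together with the swirl bound everywhere and the transfer back
(`Γ ∘ U ≡ 0 ⇒ swirl (u t) = 0` a.e.).

* `periodic_swirl_data_of_boundedWeak`, `swirl_ae_eq_zero_of_repr`.

## References

* Z. Lei, X. Ren, Q. S. Zhang, arXiv:1902.11229, §1 (1.4)–(1.5) and the proof of Theorem 1.1
  (arXiv pp. 2–4, 9). [LeiRenZhang2019]
* G. Koch, N. Nadirashvili, G. Seregin, V. Šverák, Acta Math. 203 (2009), §4 (4.6)–(4.8).
  [KNSS2009]
-/

noncomputable section

open MeasureTheory Set Function Filter InnerProductSpace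
open scoped RealInnerProductSpace Laplacian ContDiff

namespace Literature.Analysis.FluidPDE

namespace LeiRenZhang2019

/-- **Transfer back to the weak solution**: if `u t = U t + β t e_z` a.e. for a.e. `t < 0` and
`swirl (U t) ≡ 0` for all `t < 0`, then `swirl (u t) = 0` a.e. for a.e. `t < 0` (the swirl does
not see the axial constant). [cite: LeiRenZhang2019, proof of Thm 1.1 (arXiv p. 9: "This shows that Γ ≡ 0 and therefore v = v_r e_r + v_z e_z")] -/
theorem swirl_ae_eq_zero_of_repr {u U : ℝ → EuclideanSpace ℝ (Fin 3) → EuclideanSpace ℝ (Fin 3)}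
    {β : ℝ → ℝ}
    (hrep : ∀ᵐ t ∂((volume : Measure ℝ).restrict (Iio 0)), u t =ᵐ[volume] fun x => U t x + β t • eZ)
    (hU0 : ∀ t < 0, ∀ x, swirl (U t) x = 0) :
    ∀ᵐ t ∂((volume : Measure ℝ).restrict (Iio 0)),
      swirl (u t) =ᵐ[volume] (0 : EuclideanSpace ℝ (Fin 3) → ℝ) := by
  filter_upwards [hrep, ae_restrict_mem measurableSet_Iio] with t ht htneg
  filter_upwards [ht] with x hx
  rw [show swirl (u t) x = swirl (fun y => U t y + β t • eZ) x by simp only [swirl, hx],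
    swirl_add_smul_eZ, hU0 t htneg x, Pi.zero_apply]

set_option maxHeartbeats 800000 in
/-- **The smooth periodic swirl data** (proof of Theorem 1.1 with KNSS §4 in place of "mild ⇒
smooth"): a bounded weak Navier–Stokes solution (`ν = 1`) on `ℝ³ × (−∞, 0)` with
a.e.-axisymmetric slices, swirl bounded by `C` a.e. and a.e. axially `P`-periodic slices
(`P > 0`) has a representative `U(t) + β(t) e_z` (`u t = U t + β t e_z` a.e. for a.e. `t < 0`)
with: `Γ(t) = swirl (U t)` of class `C²`, jointly continuous together with `∇Γ`, `ΔΓ` on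
`t < 0`, axisymmetric, vanishing on the axis, axially `P`-periodic, `|Γ| ≤ C` everywhere;
`U(t)` smooth, divergence-free, axisymmetric, axially `P`-periodic, jointly measurable,
`‖U‖ ≤ C_U`, `‖DU‖ ≤ C₁`; `β` measurable, `|β| ≤ C_β`; and the swirl equation (1.5) integrated in
time off the axis with drift `U + β e_z` — the hypotheses `h1`–`h11` of
`bundle_of_periodic_swirl_setting`. [cite: LeiRenZhang2019, §1 (1.5) and proof of Thm 1.1 (arXiv pp. 2–4, 9); KNSS2009, §4 (4.6)–(4.8)] -/
theorem periodic_swirl_data_of_boundedWeak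
    {u : ℝ → EuclideanSpace ℝ (Fin 3) → EuclideanSpace ℝ (Fin 3)}
    (hu : IsBoundedWeakNSSolutionOn (Iio 0) isOpen_Iio 1 u)
    (haxi : ∀ θ : ℝ, ∀ᵐ t ∂((volume : Measure ℝ).restrict (Iio 0)),
      (fun x => u t (rotZ θ x)) =ᵐ[volume] fun x => rotZ θ (u t x))
    {C : ℝ} (hC : ∀ᵐ t ∂((volume : Measure ℝ).restrict (Iio 0)),
      ∀ᵐ x ∂(volume : Measure (EuclideanSpace ℝ (Fin 3))), |swirl (u t) x| ≤ C)
    {P : ℝ} (hper : ∀ᵐ t ∂((volume : Measure ℝ).restrict (Iio 0)),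
      (fun x => u t (x + P • eZ)) =ᵐ[volume] u t) :
    ∃ (U : ℝ → EuclideanSpace ℝ (Fin 3) → EuclideanSpace ℝ (Fin 3)) (β : ℝ → ℝ) (CU C₁ Cβ : ℝ),
      (∀ᵐ t ∂((volume : Measure ℝ).restrict (Iio 0)), u t =ᵐ[volume] fun x => U t x + β t • eZ) ∧
      (∀ t < 0, ContDiff ℝ 2 (fun x => swirl (U t) x)) ∧
      ContinuousOn (fun p : ℝ × EuclideanSpace ℝ (Fin 3) => swirl (U p.1) p.2) (Iio 0 ×ˢ univ) ∧
      ContinuousOn (fun p : ℝ × EuclideanSpace ℝ (Fin 3) => fderiv ℝ (fun x => swirl (U p.1) x) p.2)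
        (Iio 0 ×ˢ univ) ∧
      ContinuousOn (fun p : ℝ × EuclideanSpace ℝ (Fin 3) => (Δ fun x => swirl (U p.1) x) p.2)
        (Iio 0 ×ˢ univ) ∧
      (∀ t < 0, IsAxisymmetricScalar (fun x => swirl (U t) x)) ∧
      (∀ t < 0, ∀ x, cylRadius x = 0 → (fun x => swirl (U t) x) x = 0) ∧
      (∀ t < 0, IsAxiallyPeriodic P (fun x => swirl (U t) x)) ∧
      (∀ t < 0, ContDiff ℝ ∞ (U t)) ∧ (∀ t < 0, VectorCalculus.IsDivFree (U t)) ∧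
      (∀ t < 0, IsAxisymmetric (U t)) ∧ (∀ t < 0, IsAxiallyPeriodic P (U t)) ∧
      Measurable (uncurry U) ∧ Measurable β ∧
      (∀ t < 0, ∀ x, ‖U t x‖ ≤ CU) ∧ (∀ t < 0, ∀ x, ‖fderiv ℝ (U t) x‖ ≤ C₁) ∧
      (∀ t, |β t| ≤ Cβ) ∧
      (∀ t < 0, ∀ x, |swirl (U t) x| ≤ C) ∧
      (∀ x, cylRadius x ≠ 0 → ∀ s t : ℝ, s ≤ t → t < 0 →
        swirl (U t) x - swirl (U s) x =
          ∫ τ in s..t, ((Δ (swirl (U τ))) x - fderiv ℝ (swirl (U τ)) x (U τ x + β τ • eZ) -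
            2 / cylRadius x * partialDeriv (eR x) (swirl (U τ)) x)) := by
  obtain ⟨U, β, hβm, ⟨Cβ, hCβ⟩, hUm, hrep, hsmooth, hdiv, haxiU, hbdU, hlip, hswirlEq⟩ :=
    KNSS2009_regularity_axisymmetric_swirl_holds hu haxi
  obtain ⟨C₀, hC₀⟩ := hbdU 0
  obtain ⟨C₁, hC₁⟩ := hbdU 1
  set S : Set (ℝ × EuclideanSpace ℝ (Fin 3)) := Iio 0 ×ˢ univ with hS
  have hU2 : ∀ t < 0, ContDiff ℝ 2 (U t) := fun t ht => (hsmooth t ht).of_le (by norm_cast)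
  have hU1 : ∀ t < 0, ContDiff ℝ 1 (U t) := fun t ht => (hsmooth t ht).of_le (by norm_cast)
  have hUd : ∀ t < 0, ∀ x, DifferentiableAt ℝ (U t) x := fun t ht x =>
    ((hU1 t ht).differentiable one_ne_zero) x
  have hUb : ∀ t < 0, ∀ x, ‖U t x‖ ≤ C₀ := fun t ht x => by
    have h := hC₀ t ht x
    rwa [norm_iteratedFDeriv_zero] at h
  have hDU : ∀ t < 0, ∀ x, ‖fderiv ℝ (U t) x‖ ≤ C₁ := fun t ht x => by
    have h := hC₁ t ht x
    rwa [← norm_iteratedFDeriv_fderiv, norm_iteratedFDeriv_zero] at h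
  -- joint continuity of `U`, `∇U`, `∇²U`
  have hD : ∀ k : ℕ, ContinuousOn (fun p : ℝ × EuclideanSpace ℝ (Fin 3) => iteratedFDeriv ℝ k (U p.1) p.2) S := by
    intro k
    obtain ⟨Lk, hLk⟩ := hlip k
    exact continuousOn_iteratedFDeriv_of_lipschitz hsmooth hLk
  have hUc : ContinuousOn (fun p : ℝ × EuclideanSpace ℝ (Fin 3) => U p.1 p.2) S := by
    have h := (ContinuousMultilinearMap.apply ℝ (fun _ : Fin 0 => EuclideanSpace ℝ (Fin 3)) (EuclideanSpace ℝ (Fin 3))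
      (Fin.elim0 : Fin 0 → EuclideanSpace ℝ (Fin 3))).continuous.comp_continuousOn (hD 0)
    refine h.congr fun p _ => ?_
    simp only [comp_apply, ContinuousMultilinearMap.apply_apply, iteratedFDeriv_zero_apply]
  have hD1c : ∀ y : EuclideanSpace ℝ (Fin 3),
      ContinuousOn (fun p : ℝ × EuclideanSpace ℝ (Fin 3) => fderiv ℝ (U p.1) p.2 y) S := by
    intro y
    have h := (ContinuousMultilinearMap.apply ℝ (fun _ : Fin 1 => EuclideanSpace ℝ (Fin 3)) (EuclideanSpace ℝ (Fin 3))
      (fun _ => y)).continuous.comp_continuousOn (hD 1)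
    refine h.congr fun p _ => ?_
    simp only [comp_apply, ContinuousMultilinearMap.apply_apply, iteratedFDeriv_one_apply]
  have hD2c : ∀ m : Fin 2 → EuclideanSpace ℝ (Fin 3),
      ContinuousOn (fun p : ℝ × EuclideanSpace ℝ (Fin 3) => iteratedFDeriv ℝ 2 (U p.1) p.2 m) S := fun m =>
    (ContinuousMultilinearMap.apply ℝ (fun _ : Fin 2 => EuclideanSpace ℝ (Fin 3)) (EuclideanSpace ℝ (Fin 3)) m).continuous.comp_continuousOn
      (hD 2)
  have hUt : ∀ x, ContinuousOn (fun s : ℝ => U s x) (Iio 0) := by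
    intro x
    have hc : Continuous fun s : ℝ => ((s, x) : ℝ × EuclideanSpace ℝ (Fin 3)) := by fun_prop
    exact hUc.comp hc.continuousOn fun s hs => ⟨hs, mem_univ _⟩
  have hΓt : ∀ x, ContinuousOn (fun s : ℝ => swirl (U s) x) (Iio 0) := by
    intro x
    simp only [swirl]
    exact ((continuousOn_const.mul ((PiLp.continuous_apply 2 _ 1).comp_continuousOn (hUt x))).sub
      (continuousOn_const.mul ((PiLp.continuous_apply 2 _ 0).comp_continuousOn (hUt x))))
  have hΓxc : ∀ t < 0, Continuous (swirl (U t)) := fun t ht => (contDiff_swirl (hU1 t ht)).continuous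
  -- `Γ`: smoothness, joint continuity of `Γ`, `∇Γ`, `ΔΓ`
  have p1 : ∀ t < 0, ContDiff ℝ 2 (fun x => swirl (U t) x) := fun t ht => contDiff_swirl (hU2 t ht)
  have pfc : ContinuousOn (fun p : ℝ × EuclideanSpace ℝ (Fin 3) => swirl (U p.1) p.2) S := by
    simp only [swirl]
    exact ((((PiLp.continuous_apply 2 _ 0).comp continuous_snd).continuousOn).mul
      ((PiLp.continuous_apply 2 _ 1).comp_continuousOn hUc)).sub
      ((((PiLp.continuous_apply 2 _ 1).comp continuous_snd).continuousOn).mul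
        ((PiLp.continuous_apply 2 _ 0).comp_continuousOn hUc))
  have p2 : ContinuousOn (fun p : ℝ × EuclideanSpace ℝ (Fin 3) => fderiv ℝ (fun x => swirl (U p.1) x) p.2) S := by
    refine continuousOn_clm_apply.2 fun y => ?_
    have hG : ContinuousOn
        (fun p : ℝ × EuclideanSpace ℝ (Fin 3) => ⟪rotGen p.2, fderiv ℝ (U p.1) p.2 y⟫ + ⟪rotGen y, U p.1 p.2⟫) S :=
      ((rotGenL.continuous.comp continuous_snd).continuousOn.inner (hD1c y)).add
        (continuousOn_const.inner hUc)
    refine hG.congr fun p hp => ?_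
    exact fderiv_swirl_apply (hUd p.1 hp.1 p.2) y
  have p3 : ContinuousOn (fun p : ℝ × EuclideanSpace ℝ (Fin 3) => (Δ fun x => swirl (U p.1) x) p.2) S := by
    classical
    set b := EuclideanSpace.basisFun (Fin 3) ℝ with hb
    have hΔU : ContinuousOn (fun p : ℝ × EuclideanSpace ℝ (Fin 3) => (Δ (U p.1)) p.2) S := by
      have h : ContinuousOn
          (fun p : ℝ × EuclideanSpace ℝ (Fin 3) => ∑ i, iteratedFDeriv ℝ 2 (U p.1) p.2 ![b i, b i]) S :=
        continuousOn_finsetSum _ fun i _ => hD2c _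
      refine h.congr fun p _ => ?_
      exact congrFun (laplacian_eq_iteratedFDeriv_orthonormalBasis (U p.1) b) p.2
    have hG : ContinuousOn (fun p : ℝ × EuclideanSpace ℝ (Fin 3) => ⟪rotGen p.2, (Δ (U p.1)) p.2⟫ +
        2 * (fderiv ℝ (U p.1) p.2 (EuclideanSpace.single 0 1) 1 -
          fderiv ℝ (U p.1) p.2 (EuclideanSpace.single 1 1) 0)) S :=
      ((rotGenL.continuous.comp continuous_snd).continuousOn.inner hΔU).add
        (continuousOn_const.mul
          (((PiLp.continuous_apply 2 _ 1).comp_continuousOn (hD1c _)).sub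
            ((PiLp.continuous_apply 2 _ 0).comp_continuousOn (hD1c _))))
    refine hG.congr fun p hp => ?_
    exact laplacian_swirl (hU2 p.1 hp.1) p.2
  have p4 : ∀ t < 0, IsAxisymmetricScalar (fun x => swirl (U t) x) := fun t ht =>
    (haxiU t ht).isAxisymmetricScalar_swirl
  have p5 : ∀ t < 0, ∀ x, cylRadius x = 0 → (fun x => swirl (U t) x) x = 0 := fun t _ x hx =>
    swirl_eq_zero_of_cylRadius_eq_zero _ hx
  -- for a.e. `t`: `swirl (U t) = swirl (u t)` a.e. and `U t` periodic a.e.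
  have hΓae : ∀ᵐ t ∂((volume : Measure ℝ).restrict (Iio 0)),
      ∀ᵐ x ∂(volume : Measure (EuclideanSpace ℝ (Fin 3))), swirl (U t) x = swirl (u t) x := by
    filter_upwards [hrep] with t ht
    filter_upwards [ht] with x hx
    simp [swirl, hx, eZ]
  -- the swirl bound everywhere
  have p6 : ∀ t < 0, ∀ x, |swirl (U t) x| ≤ C := by
    have hae : ∀ᵐ t ∂((volume : Measure ℝ).restrict (Iio 0)), ∀ x, |swirl (U t) x| ≤ C := by
      filter_upwards [hΓae, hC, ae_restrict_mem measurableSet_Iio] with t ht hCt htneg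
      have h1 : ∀ᵐ x ∂(volume : Measure (EuclideanSpace ℝ (Fin 3))), |swirl (U t) x| ≤ C := by
        filter_upwards [ht, hCt] with x hx hCx
        rw [hx]; exact hCx
      have h := SereginSverak2009.forall_le_of_ae_le_of_continuousOn isOpen_univ
        ((hΓxc t htneg).abs.continuousOn) continuousOn_const (by rwa [Measure.restrict_univ])
      exact fun x => h x (mem_univ x)
    intro t ht x
    refine forall_Iio_le_of_ae ((hΓt x).abs) ?_ t ht
    filter_upwards [hae] with s hs
    exact hs x
  -- periodicity of `U t` for every `t < 0`
  have hperU : ∀ t < 0, IsAxiallyPeriodic P (U t) := by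
    have hmp : MeasurePreserving (fun x : EuclideanSpace ℝ (Fin 3) => x + P • eZ) volume volume :=
      measurePreserving_add_right volume (P • eZ)
    have hae : ∀ᵐ t ∂((volume : Measure ℝ).restrict (Iio 0)), ∀ x, U t (x + P • eZ) = U t x := by
      filter_upwards [hrep, hper, ae_restrict_mem measurableSet_Iio] with t ht hpt htneg
      -- `U t ∘ T + β e_z = u t ∘ T = u t = U t + β e_z` a.e.
      have e1 : (fun x => u t (x + P • eZ)) =ᵐ[volume] fun x => U t (x + P • eZ) + β t • eZ :=
        hmp.quasiMeasurePreserving.ae ht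
      have e2 : (fun x => U t (x + P • eZ) + β t • eZ) =ᵐ[volume] fun x => U t x + β t • eZ :=
        (e1.symm.trans hpt).trans ht
      have e3 : (fun x => U t (x + P • eZ)) =ᵐ[volume] U t := by
        filter_upwards [e2] with x hx
        simpa using hx
      have hc1 : Continuous fun x => U t (x + P • eZ) :=
        (hsmooth t htneg).continuous.comp (continuous_id.add continuous_const)
      have h := (Continuous.ae_eq_iff_eq (μ := (volume : Measure (EuclideanSpace ℝ (Fin 3)))) hc1
        (hsmooth t htneg).continuous).1 e3
      exact fun x => congrFun h x
    intro t ht x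
    -- both sides are continuous in `t` on `(−∞, 0)` and agree for a.e. `t`
    have hc1 : ContinuousOn (fun s : ℝ => U s (x + P • eZ) - U s x) (Iio 0) := (hUt _).sub (hUt x)
    have hz : ∀ᵐ s ∂((volume : Measure ℝ).restrict (Iio 0)), U s (x + P • eZ) - U s x = 0 := by
      filter_upwards [hae] with s hs
      rw [hs x, sub_self]
    have hle : ∀ i : Fin 3, ∀ s < 0, (U s (x + P • eZ) - U s x) i ≤ 0 := by
      intro i
      refine forall_Iio_le_of_ae ((PiLp.continuous_apply 2 _ i).comp_continuousOn hc1) ?_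
      filter_upwards [hz] with s hs
      rw [hs]; simp
    have hge : ∀ i : Fin 3, ∀ s < 0, -(U s (x + P • eZ) - U s x) i ≤ 0 := by
      intro i
      refine forall_Iio_le_of_ae (((PiLp.continuous_apply 2 _ i).comp_continuousOn hc1).neg) ?_
      filter_upwards [hz] with s hs
      rw [hs]; simp
    have h0 : U t (x + P • eZ) - U t x = 0 := by
      ext i
      have h1 := hle i t ht
      have h2 := hge i t ht
      simp only [PiLp.zero_apply]
      linarith
    exact sub_eq_zero.1 h0
  have p6p : ∀ t < 0, IsAxiallyPeriodic P (fun x => swirl (U t) x) := by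
    intro t ht x
    show swirl (U t) (x + P • eZ) = swirl (U t) x
    have h : U t (x + P • eZ) = U t x := hperU t ht x
    simp only [swirl]
    rw [h]
    simp [eZ]
  refine ⟨U, β, C₀, C₁, Cβ, hrep, p1, pfc, p2, p3, p4, p5, p6p, hsmooth, hdiv, haxiU, hperU, hUm, hβm,
    hUb, hDU, hCβ, p6, hswirlEq⟩

end LeiRenZhang2019

end Literature.Analysis.FluidPDE

end
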